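import Mathlib
import Summits.ResolutionOfSingularities.ResolutionOfSingularities.Theorems.WeightedInvariantLocalWeightedDropNCDirectrixCutBadAxis
import Summits.ResolutionOfSingularities.ResolutionOfSingularities.Theorems.WeightedInvariantLocalWeightedDropNCResPhaseAssembly
import Summits.ResolutionOfSingularities.ResolutionOfSingularities.Theorems.WeightedInvariantLocalWeightedDropTOT2E1Step
import Summits.ResolutionOfSingularities.ResolutionOfSingularities.Theorems.WeightedInvariantLocalWeightedDropTOT2NearOld
import Summits.ResolutionOfSingularities.ResolutionOfSingularities.Theorems.WeightedInvariantLocalWeightedDropNCTameBinomialEndGame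

/-!
# `WeightedInvariant.LocalWeightedDrop`: LINE `directrix-cut`, the `(o, |O|) = (2, 0)` corner — MONO₂ (1/2): THE CODIMENSION-TWO MOVE OF A MONOMIAL PAIR

OURS (res-L1-w43-stub-4 g6 for the ENGINE crux `LocalWeightedDrop` stmt-ResolutionOfSingularities-8899, W′|₄ line; candidates, not facts;
counted 0). The statement of `monomialPairExit` is THE TEXT of res-L1-w43-strat-1's `stub_monomialPairExit` (g11 `r2_split_v1.lean`,
sha16 e295f84f594a1ad7, l.68–80): from an admissibly decorated position with `o = 2`, `O = ∅`, whose equation reads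
`u · X₀ · (X₀ + v · ∏_t X_{t+1}^{α_t})` (`u, v` units) through a legal coordinate change `Φ` straight on the boundary and with no boundary
component on `X₀`, the mover forces «NC, or admissible with smaller head, or admissible with the same head and not a unary vertex».

THIS FILE (1/2) is the codimension-two MOVE `(Φ, 𝟙_{0,i})` (`α_i ≥ 1`) of the induction on `|α|`: it is B-permissible (the pair has
`𝟙_{0,i}`-order `2 = c`, `isBPermissible_pair`); its restricted chart is computed from `Decoration.fChart_eq` / `Decoration.satExp_fChart_eq_o` /
`SliceChart.subst_restrictedChart` (`X_sq_mul_strict`), giving the strict transforms at the slot `i` (`strict_slot_i`) and at the slot `0`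
(`strict_slot_zero`) in closed form; with `|α| ≥ 2`, at the slot `0` and at the slot `i` with `c₀ ≠ 0` the strict transform is a unit
(`constantCoeff_strict_ne_zero`), so the head drops (`head_lt_of_constantCoeff_strict`: were it kept, the new equation would be the strict
transform itself, of order `o ≥ 1`). The kept-head answer, the sizes `0, 1` and the assembly are in `…NCDirectrixCutMonomialPair` (2/2).
-/

set_option linter.dupNamespace false

noncomputable section

namespace Summit.ResolutionOfSingularities.ResolutionOfSingularities.Theorems

namespace TameFourTupleDrop

namespace MonomialPair

open MvPowerSeries Literature.AlgebraicGeometry.Resolution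

variable {k : Type} [Field k]

/-! ## The restricted chart of the move `(Φ, 𝟙_{0,i})` -/

/-- The weights `𝟙_{0,i}` of the codimension-two move. -/
theorem w01_le_one (i l : Fin 4) : (fun l : Fin 4 => if l = 0 ∨ l = i then (1 : ℕ) else 0) l ≤ 1 := by
  dsimp only; split_ifs <;> simp

/-- The restricted chart family at the live slot `j` may be substituted. -/
theorem hasSubst_rho {w : Fin 4 → ℕ} {c : Fin 4 → k} (hc : ∀ l, w l = 0 → c l = 0) (j : Fin 4) :
    HasSubst (fun l : Fin 4 => X 0 ^ (w l) * (C (c l) + if l = j then (0 : MvPowerSeries (Fin 4) k) else X (Fin.predAbove j l.succ))) := by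
  refine hasSubst_of_constantCoeff_zero fun l => ?_
  by_cases hw : w l = 0
  · simp [hw, hc l hw]
    split_ifs <;> simp [constantCoeff_X]
  · simp [constantCoeff_X, zero_pow hw]

/-- The restricted chart image of the monomial pair, as a product of the images of its factors. -/
theorem subst_rho_pair {ρ : Fin 4 → MvPowerSeries (Fin 4) k} (hρ : HasSubst ρ) (u v : MvPowerSeries (Fin 4) k) (α : Fin 3 → ℕ) :
    subst ρ (u * (X 0 * (X 0 + v * ∏ t : Fin 3, X (Fin.succ t) ^ α t))) =
      subst ρ u * (ρ 0 * (ρ 0 + subst ρ v * ∏ t : Fin 3, ρ (Fin.succ t) ^ α t)) := by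
  rw [← coe_substAlgHom hρ]
  simp only [map_mul, map_add, map_prod, map_pow, coe_substAlgHom, subst_X hρ]

/-- Splitting the letter product at the distinguished letter `i'`. -/
theorem prod_split (F : Fin 3 → MvPowerSeries (Fin 4) k) (α : Fin 3 → ℕ) (i' : Fin 3) :
    ∏ t : Fin 3, F t ^ α t = F i' ^ α i' * ∏ t ∈ Finset.univ.erase i', F t ^ α t := by
  rw [← Finset.mul_prod_erase Finset.univ (fun t => F t ^ α t) (Finset.mem_univ i')]


/-! ## B-permissibility of the move `(Φ, 𝟙_{0,i})` from a monomial pair presentation -/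

/-- The `w`-weighted order of a letter is at least its weight. -/
theorem le_weightedOrder_X (w : Fin 4 → ℕ) (l : Fin 4) : ((w l : ℕ) : ℕ∞) ≤ (X l : MvPowerSeries (Fin 4) k).weightedOrder w := by
  refine le_weightedOrder _ fun d hd => ?_
  rw [coeff_X, if_neg]
  rintro rfl
  rw [Finsupp.weight_apply, Finsupp.sum_single_index (by simp), one_smul] at hd
  exact lt_irrefl _ hd

/-- The pair `u·x₀·(x₀ + v·x^α)` has `𝟙_{0,i}`-weighted order `≥ 2` when `α_{i'} ≥ 1` (`i = i'⁺`). -/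
theorem two_le_weightedOrder_pair (u v : MvPowerSeries (Fin 4) k) {α : Fin 3 → ℕ} {i' : Fin 3} (hαi : 1 ≤ α i') :
    (2 : ℕ∞) ≤ (u * (X 0 * (X 0 + v * ∏ t : Fin 3, X (Fin.succ t) ^ α t))).weightedOrder
      (fun l : Fin 4 => if l = 0 ∨ l = i'.succ then 1 else 0) := by
  set w : Fin 4 → ℕ := fun l => if l = 0 ∨ l = i'.succ then 1 else 0 with hw
  have h0 : (1 : ℕ∞) ≤ (X 0 : MvPowerSeries (Fin 4) k).weightedOrder w := by
    have h := le_weightedOrder_X (k := k) w 0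
    simp only [hw, true_or, ↓reduceIte, Nat.cast_one] at h
    exact h
  have hi : (1 : ℕ∞) ≤ (X i'.succ : MvPowerSeries (Fin 4) k).weightedOrder w := by
    have h := le_weightedOrder_X (k := k) w i'.succ
    simp only [hw, or_true, ↓reduceIte, Nat.cast_one] at h
    exact h
  have hpow : ((α i' : ℕ) : ℕ∞) ≤ ((X i'.succ : MvPowerSeries (Fin 4) k) ^ α i').weightedOrder w :=
    calc ((α i' : ℕ) : ℕ∞) = α i' • (1 : ℕ∞) := by simp
      _ ≤ α i' • (X i'.succ : MvPowerSeries (Fin 4) k).weightedOrder w := nsmul_le_nsmul_right hi _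
      _ ≤ _ := le_weightedOrder_pow w (α i')
  have hmon : (1 : ℕ∞) ≤ (∏ t : Fin 3, (X (Fin.succ t) : MvPowerSeries (Fin 4) k) ^ α t).weightedOrder w := by
    rw [prod_split _ α i']
    calc (1 : ℕ∞) ≤ ((α i' : ℕ) : ℕ∞) := by exact_mod_cast hαi
      _ ≤ ((X i'.succ : MvPowerSeries (Fin 4) k) ^ α i').weightedOrder w := hpow
      _ ≤ ((X i'.succ : MvPowerSeries (Fin 4) k) ^ α i').weightedOrder w +
            (∏ t ∈ Finset.univ.erase i', (X (Fin.succ t) : MvPowerSeries (Fin 4) k) ^ α t).weightedOrder w := le_self_add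
      _ ≤ _ := le_weightedOrder_mul w
  have hbr : (1 : ℕ∞) ≤ (X 0 + v * ∏ t : Fin 3, (X (Fin.succ t) : MvPowerSeries (Fin 4) k) ^ α t).weightedOrder w := by
    refine le_trans (le_min h0 ?_) (min_weightedOrder_le_add w)
    calc (1 : ℕ∞) ≤ v.weightedOrder w + (∏ t : Fin 3, (X (Fin.succ t) : MvPowerSeries (Fin 4) k) ^ α t).weightedOrder w :=
          le_add_left hmon
      _ ≤ _ := le_weightedOrder_mul w
  calc (2 : ℕ∞) = 1 + 1 := by norm_num
    _ ≤ (X 0 : MvPowerSeries (Fin 4) k).weightedOrder w + (X 0 + v * ∏ t : Fin 3, (X (Fin.succ t) : MvPowerSeries (Fin 4) k) ^ α t).weightedOrder w :=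
        add_le_add h0 hbr
    _ ≤ (X 0 * (X 0 + v * ∏ t : Fin 3, (X (Fin.succ t) : MvPowerSeries (Fin 4) k) ^ α t)).weightedOrder w := le_weightedOrder_mul w
    _ ≤ u.weightedOrder w + (X 0 * (X 0 + v * ∏ t : Fin 3, (X (Fin.succ t) : MvPowerSeries (Fin 4) k) ^ α t)).weightedOrder w := le_add_self
    _ ≤ _ := le_weightedOrder_mul w

/-- The move `(Φ, 𝟙_{0,i})` is a count move. -/
theorem isCountMove_pair {Φ : Fin 4 → MvPowerSeries (Fin 4) k} (hΦ0 : ∀ l, constantCoeff (Φ l) = 0)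
    (hΦdet : IsUnit (Matrix.det (Matrix.of fun i j => coeff (Finsupp.single j 1) (Φ i)))) (i' : Fin 3) :
    IsCountMove Φ (fun l : Fin 4 => if l = 0 ∨ l = i'.succ then 1 else 0) :=
  ⟨hΦ0, hΦdet, fun l => by dsimp only; split_ifs <;> simp, ⟨0, by simp⟩⟩

/-- **THE MOVE `(Φ, 𝟙_{0,i})` IS B-PERMISSIBLE** from a monomial pair presentation with `α_{i'} ≥ 1` (`O = ∅`, `o = 2`). -/
theorem isBPermissible_pair {b : MvPowerSeries (Fin 4) k} {δ : Decoration k 3} (hadm : Admissible b δ) (hO : δ.O = ∅) (ho : δ.o = 2)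
    {Φ : Fin 4 → MvPowerSeries (Fin 4) k} {u v : MvPowerSeries (Fin 4) k} {α : Fin 3 → ℕ} (hΦ0 : ∀ l, constantCoeff (Φ l) = 0)
    (hΦdet : IsUnit (Matrix.det (Matrix.of fun i j => coeff (Finsupp.single j 1) (Φ i))))
    (hE : ∀ l ∈ δ.E, ∃ (l' : Fin 4) (w : MvPowerSeries (Fin 4) k), l' ≠ 0 ∧ constantCoeff w ≠ 0 ∧ Φ l = w * X l')
    (hf : subst Φ δ.f = u * (X 0 * (X 0 + v * ∏ t : Fin 3, X (Fin.succ t) ^ α t))) {i' : Fin 3} (hαi : 1 ≤ α i') :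
    IsBPermissible δ Φ (fun l : Fin 4 => if l = 0 ∨ l = i'.succ then 1 else 0) := by
  have hc : δ.c = 2 := by rw [Decoration.c, hO, Finset.card_empty, add_zero, ho]
  refine isBPermissible_of_totalO_weightedOrder hadm (isCountMove_pair hΦ0 hΦdet i')
    (fun l hl => by obtain ⟨l', w, -, hw, he⟩ := hE l hl; exact ⟨l', w, hw, he⟩) ?_
  rw [hO, Finset.prod_empty, mul_one, hf, hc]
  exact_mod_cast two_le_weightedOrder_pair u v hαi


/-! ## The strict transform at the answers of the move `(Φ, 𝟙_{0,i})` -/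

/-- `predAbove (succ i') 1 = 1`. -/
theorem predAbove_succ_one (i' : Fin 3) : Fin.predAbove (i'.succ : Fin 4) (1 : Fin 5) = 1 := by
  fin_cases i' <;> decide

/-- THE RESTRICTED CHART IMAGE IS `s² ·` THE STRICT TRANSFORM (any live slot `j`). -/
theorem X_sq_mul_strict {b : MvPowerSeries (Fin 4) k} {δ : Decoration k 3} (hadm : Admissible b δ) (hO : δ.O = ∅) (ho : δ.o = 2)
    {Φ : Fin 4 → MvPowerSeries (Fin 4) k} {u v : MvPowerSeries (Fin 4) k} {α : Fin 3 → ℕ} (hΦ0 : ∀ l, constantCoeff (Φ l) = 0)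
    (hΦdet : IsUnit (Matrix.det (Matrix.of fun i j => coeff (Finsupp.single j 1) (Φ i))))
    (hE : ∀ l ∈ δ.E, ∃ (l' : Fin 4) (w : MvPowerSeries (Fin 4) k), l' ≠ 0 ∧ constantCoeff w ≠ 0 ∧ Φ l = w * X l')
    (hf : subst Φ δ.f = u * (X 0 * (X 0 + v * ∏ t : Fin 3, X (Fin.succ t) ^ α t))) {i' : Fin 3} (hαi : 1 ≤ α i')
    {c : Fin 4 → k} (hc : ∀ l, (fun l : Fin 4 => if l = 0 ∨ l = i'.succ then 1 else 0) l = 0 → c l = 0) (j : Fin 4) :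
    X 0 ^ 2 * δ.strict Φ (fun l : Fin 4 => if l = 0 ∨ l = i'.succ then 1 else 0) c j =
      subst (fun l : Fin 4 => X 0 ^ ((fun l : Fin 4 => if l = 0 ∨ l = i'.succ then 1 else 0) l) *
        (C (c l) + if l = j then (0 : MvPowerSeries (Fin 4) k) else X (Fin.predAbove j l.succ)))
        (u * (X 0 * (X 0 + v * ∏ t : Fin 3, X (Fin.succ t) ^ α t))) := by
  set w : Fin 4 → ℕ := fun l => if l = 0 ∨ l = i'.succ then 1 else 0 with hw
  have hf0 : δ.f ≠ 0 := hadm.2.1.ne_zero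
  have hmv := isCountMove_pair hΦ0 hΦdet i'
  have hperm := isBPermissible_pair hadm hO ho hΦ0 hΦdet hE hf hαi
  obtain ⟨hfac, -⟩ := Decoration.fChart_eq (δ := δ) (c := c) hmv hc hf0
  rw [Decoration.satExp_fChart_eq_o hperm hc hf0, ho] at hfac
  have h := SliceChart.subst_restrictedChart w c hc (subst Φ δ.f) 2 _ hfac j
  rw [hf] at h
  rw [h]
  rfl

/-- **THE STRICT TRANSFORM AT THE SLOT `i`** (any `c₀`): `ρu · (c₀ + y₀) · ((c₀ + y₀) + ρv · c_i^{α_i} · s^{α_i − 1} · ∏_{t ≠ i'} y_t^{α_t})` with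
`y₀ = X 1`, `s = X 0`, `y_{succ t} = X (predAbove i t⁺⁺)`. -/
theorem strict_slot_i {b : MvPowerSeries (Fin 4) k} {δ : Decoration k 3} (hadm : Admissible b δ) (hO : δ.O = ∅) (ho : δ.o = 2)
    {Φ : Fin 4 → MvPowerSeries (Fin 4) k} {u v : MvPowerSeries (Fin 4) k} {α : Fin 3 → ℕ} (hΦ0 : ∀ l, constantCoeff (Φ l) = 0)
    (hΦdet : IsUnit (Matrix.det (Matrix.of fun i j => coeff (Finsupp.single j 1) (Φ i))))
    (hE : ∀ l ∈ δ.E, ∃ (l' : Fin 4) (w : MvPowerSeries (Fin 4) k), l' ≠ 0 ∧ constantCoeff w ≠ 0 ∧ Φ l = w * X l')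
    (hf : subst Φ δ.f = u * (X 0 * (X 0 + v * ∏ t : Fin 3, X (Fin.succ t) ^ α t))) {i' : Fin 3} (hαi : 1 ≤ α i')
    {c : Fin 4 → k} (hc : ∀ l, (fun l : Fin 4 => if l = 0 ∨ l = i'.succ then 1 else 0) l = 0 → c l = 0) :
    ∃ ρ : Fin 4 → MvPowerSeries (Fin 4) k, (∀ l, constantCoeff (ρ l) = 0) ∧
      δ.strict Φ (fun l : Fin 4 => if l = 0 ∨ l = i'.succ then 1 else 0) c i'.succ =
        subst ρ u * ((C (c 0) + X 1) * ((C (c 0) + X 1) + subst ρ v * C (c i'.succ ^ α i') * X 0 ^ (α i' - 1) *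
          ∏ t ∈ Finset.univ.erase i', X (Fin.predAbove i'.succ t.succ.succ) ^ α t)) := by
  set w : Fin 4 → ℕ := fun l => if l = 0 ∨ l = i'.succ then 1 else 0 with hw
  set ρ : Fin 4 → MvPowerSeries (Fin 4) k := fun l => X 0 ^ (w l) * (C (c l) + if l = i'.succ then (0 : MvPowerSeries (Fin 4) k)
    else X (Fin.predAbove i'.succ l.succ)) with hρ
  have hρs : HasSubst ρ := hasSubst_rho hc i'.succ
  have hρ0' : ∀ l, constantCoeff (ρ l) = 0 := fun l => by
    by_cases hwl : w l = 0
    · have hcl := hc l hwl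
      simp only [hρ, hwl, pow_zero, one_mul, hcl, map_zero, zero_add]
      split_ifs <;> simp [constantCoeff_X]
    · simp [hρ, constantCoeff_X, zero_pow hwl]
  have hi0 : (i'.succ : Fin 4) ≠ 0 := Fin.succ_ne_zero i'
  have hw0 : w 0 = 1 := by simp [hw]
  have hwi : w i'.succ = 1 := by simp [hw]
  have hρ0 : ρ 0 = X 0 * (C (c 0) + X 1) := by
    simp only [hρ, hw0, pow_one, if_neg hi0.symm, Fin.succ_zero_eq_one, predAbove_succ_one]
  have hρi : ρ i'.succ = X 0 * C (c i'.succ) := by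
    simp only [hρ, hwi, pow_one, ↓reduceIte, add_zero]
  have hρt : ∀ t ∈ Finset.univ.erase i', ρ t.succ = X (Fin.predAbove i'.succ t.succ.succ) := by
    intro t ht
    have hti : t ≠ i' := Finset.ne_of_mem_erase ht
    have hne : (t.succ : Fin 4) ≠ i'.succ := fun h => hti (Fin.succ_injective _ h)
    have hwt : w t.succ = 0 := by simp [hw, Fin.succ_ne_zero, hne]
    simp only [hρ, hwt, pow_zero, one_mul, hc _ hwt, map_zero, zero_add, if_neg hne]
  refine ⟨ρ, hρ0', mul_left_cancel₀ (pow_ne_zero 2 (FormalCoordChange.X_ne_zero' (0 : Fin 4))) ?_⟩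
  rw [X_sq_mul_strict hadm hO ho hΦ0 hΦdet hE hf hαi hc i'.succ, ← hρ, subst_rho_pair hρs, prod_split _ α i', hρ0, hρi,
    Finset.prod_congr rfl fun t ht => by rw [hρt t ht]]
  have hX : (X 0 : MvPowerSeries (Fin 4) k) ^ α i' = X 0 * X 0 ^ (α i' - 1) := by
    rw [← pow_succ', Nat.sub_add_cancel hαi]
  rw [mul_pow, hX, map_pow]
  ring


/-- **THE STRICT TRANSFORM AT THE SLOT `0`** (`c₀ ≠ 0` for liveness): `ρu · c₀ · (c₀ + ρv · s^{α_i − 1} · (c_i + y_i)^{α_i} · ∏_{t ≠ i'} y_t^{α_t})`. -/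
theorem strict_slot_zero {b : MvPowerSeries (Fin 4) k} {δ : Decoration k 3} (hadm : Admissible b δ) (hO : δ.O = ∅) (ho : δ.o = 2)
    {Φ : Fin 4 → MvPowerSeries (Fin 4) k} {u v : MvPowerSeries (Fin 4) k} {α : Fin 3 → ℕ} (hΦ0 : ∀ l, constantCoeff (Φ l) = 0)
    (hΦdet : IsUnit (Matrix.det (Matrix.of fun i j => coeff (Finsupp.single j 1) (Φ i))))
    (hE : ∀ l ∈ δ.E, ∃ (l' : Fin 4) (w : MvPowerSeries (Fin 4) k), l' ≠ 0 ∧ constantCoeff w ≠ 0 ∧ Φ l = w * X l')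
    (hf : subst Φ δ.f = u * (X 0 * (X 0 + v * ∏ t : Fin 3, X (Fin.succ t) ^ α t))) {i' : Fin 3} (hαi : 1 ≤ α i')
    {c : Fin 4 → k} (hc : ∀ l, (fun l : Fin 4 => if l = 0 ∨ l = i'.succ then 1 else 0) l = 0 → c l = 0) :
    ∃ ρ : Fin 4 → MvPowerSeries (Fin 4) k, (∀ l, constantCoeff (ρ l) = 0) ∧
      δ.strict Φ (fun l : Fin 4 => if l = 0 ∨ l = i'.succ then 1 else 0) c 0 =
        subst ρ u * (C (c 0) * (C (c 0) + subst ρ v * X 0 ^ (α i' - 1) * (C (c i'.succ) + X i'.succ) ^ α i' *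
          ∏ t ∈ Finset.univ.erase i', X t.succ ^ α t)) := by
  set w : Fin 4 → ℕ := fun l => if l = 0 ∨ l = i'.succ then 1 else 0 with hw
  set ρ : Fin 4 → MvPowerSeries (Fin 4) k := fun l => X 0 ^ (w l) * (C (c l) + if l = 0 then (0 : MvPowerSeries (Fin 4) k)
    else X (Fin.predAbove 0 l.succ)) with hρ
  have hρs : HasSubst ρ := hasSubst_rho hc 0
  have hρ0' : ∀ l, constantCoeff (ρ l) = 0 := fun l => by
    by_cases hwl : w l = 0
    · have hcl := hc l hwl
      simp only [hρ, hwl, pow_zero, one_mul, hcl, map_zero, zero_add]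
      split_ifs <;> simp [constantCoeff_X]
    · simp [hρ, constantCoeff_X, zero_pow hwl]
  have hi0 : (i'.succ : Fin 4) ≠ 0 := Fin.succ_ne_zero i'
  have hw0 : w 0 = 1 := by simp [hw]
  have hwi : w i'.succ = 1 := by simp [hw]
  have hρ0 : ρ 0 = X 0 * C (c 0) := by
    simp only [hρ, hw0, pow_one, ↓reduceIte, add_zero]
  have hρi : ρ i'.succ = X 0 * (C (c i'.succ) + X i'.succ) := by
    simp only [hρ, hwi, pow_one, if_neg hi0, Fin.predAbove_zero_succ]
  have hρt : ∀ t ∈ Finset.univ.erase i', ρ t.succ = X t.succ := by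
    intro t ht
    have hti : t ≠ i' := Finset.ne_of_mem_erase ht
    have hne : (t.succ : Fin 4) ≠ i'.succ := fun h => hti (Fin.succ_injective _ h)
    have hwt : w t.succ = 0 := by simp [hw, Fin.succ_ne_zero, hne]
    simp only [hρ, hwt, pow_zero, one_mul, hc _ hwt, map_zero, zero_add, if_neg (Fin.succ_ne_zero t), Fin.predAbove_zero_succ]
  refine ⟨ρ, hρ0', mul_left_cancel₀ (pow_ne_zero 2 (FormalCoordChange.X_ne_zero' (0 : Fin 4))) ?_⟩
  rw [X_sq_mul_strict hadm hO ho hΦ0 hΦdet hE hf hαi hc 0, ← hρ, subst_rho_pair hρs, prod_split _ α i', hρ0, hρi,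
    Finset.prod_congr rfl fun t ht => by rw [hρt t ht]]
  have hX : (X 0 : MvPowerSeries (Fin 4) k) ^ α i' = X 0 * X 0 ^ (α i' - 1) := by
    rw [← pow_succ', Nat.sub_add_cancel hαi]
  rw [mul_pow, hX]
  ring

/-- WITH `|α| ≥ 2` THE CORRECTION TERM VANISHES AT THE ORIGIN: the constant term of `s^{α_i−1} · P^{α_i} · ∏_{t≠i'} y_t^{α_t}`-type products is `0`
(either `α_i ≥ 2`, or some other `α_t ≥ 1`). -/
theorem constantCoeff_correction_eq_zero {α : Fin 3 → ℕ} {i' : Fin 3} (hαi : 1 ≤ α i') (hα : 2 ≤ ∑ t, α t)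
    (A P : MvPowerSeries (Fin 4) k) (Y : Fin 3 → MvPowerSeries (Fin 4) k) (hY : ∀ t, constantCoeff (Y t) = 0) :
    constantCoeff (A * X 0 ^ (α i' - 1) * P * ∏ t ∈ Finset.univ.erase i', Y t ^ α t) = 0 := by
  by_cases h2 : 2 ≤ α i'
  · have : constantCoeff ((X 0 : MvPowerSeries (Fin 4) k) ^ (α i' - 1)) = 0 := by
      rw [map_pow, constantCoeff_X, zero_pow (by omega)]
    simp [this]
  · -- some other exponent is positive
    have hex : ∃ t ∈ Finset.univ.erase i', 1 ≤ α t := by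
      by_contra hno
      push Not at hno
      have hsum : ∑ t, α t = α i' + ∑ t ∈ Finset.univ.erase i', α t := (Finset.add_sum_erase _ _ (Finset.mem_univ i')).symm
      have hz : ∑ t ∈ Finset.univ.erase i', α t = 0 := Finset.sum_eq_zero fun t ht => by have := hno t ht; omega
      omega
    obtain ⟨t, ht, hαt⟩ := hex
    have : constantCoeff (∏ t ∈ Finset.univ.erase i', Y t ^ α t) = 0 := by
      rw [map_prod]
      exact Finset.prod_eq_zero ht (by rw [map_pow, hY t, zero_pow (by omega)])
    simp [this]

/-- **OFF THE KEPT-HEAD ANSWER THE STRICT TRANSFORM IS A UNIT** (`|α| ≥ 2`): at the slot `0`, and at the slot `i` with `c₀ ≠ 0`. -/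
theorem constantCoeff_strict_ne_zero {b : MvPowerSeries (Fin 4) k} {δ : Decoration k 3} (hadm : Admissible b δ) (hO : δ.O = ∅) (ho : δ.o = 2)
    {Φ : Fin 4 → MvPowerSeries (Fin 4) k} {u v : MvPowerSeries (Fin 4) k} {α : Fin 3 → ℕ} (hΦ0 : ∀ l, constantCoeff (Φ l) = 0)
    (hΦdet : IsUnit (Matrix.det (Matrix.of fun i j => coeff (Finsupp.single j 1) (Φ i))))
    (hE : ∀ l ∈ δ.E, ∃ (l' : Fin 4) (w : MvPowerSeries (Fin 4) k), l' ≠ 0 ∧ constantCoeff w ≠ 0 ∧ Φ l = w * X l')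
    (hu : constantCoeff u ≠ 0) (hf : subst Φ δ.f = u * (X 0 * (X 0 + v * ∏ t : Fin 3, X (Fin.succ t) ^ α t)))
    {i' : Fin 3} (hαi : 1 ≤ α i') (hα : 2 ≤ ∑ t, α t)
    {c : Fin 4 → k} (hc : ∀ l, (fun l : Fin 4 => if l = 0 ∨ l = i'.succ then 1 else 0) l = 0 → c l = 0) (hc0 : c 0 ≠ 0)
    {j : Fin 4} (hj : j = 0 ∨ j = i'.succ) :
    constantCoeff (δ.strict Φ (fun l : Fin 4 => if l = 0 ∨ l = i'.succ then 1 else 0) c j) ≠ 0 := by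
  rcases hj with rfl | rfl
  · obtain ⟨ρ, hρ0, hS⟩ := strict_slot_zero hadm hO ho hΦ0 hΦdet hE hf hαi hc
    have hρu : constantCoeff (subst ρ u) = constantCoeff u := TOT2E1.constantCoeff_subst_of_constantCoeff_zero _ hρ0 u
    have hcorr := constantCoeff_correction_eq_zero hαi hα (subst ρ v) ((C (c i'.succ) + X i'.succ) ^ α i') (fun t => X t.succ)
      (fun t => constantCoeff_X _)
    rw [hS, map_mul, map_mul, map_add, hcorr, add_zero, constantCoeff_C, hρu]
    exact mul_ne_zero hu (mul_ne_zero hc0 hc0)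
  · obtain ⟨ρ, hρ0, hS⟩ := strict_slot_i hadm hO ho hΦ0 hΦdet hE hf hαi hc
    have hρu : constantCoeff (subst ρ u) = constantCoeff u := TOT2E1.constantCoeff_subst_of_constantCoeff_zero _ hρ0 u
    have hcorr := constantCoeff_correction_eq_zero hαi hα (subst ρ v * C (c i'.succ ^ α i')) 1
      (fun t => X (Fin.predAbove i'.succ t.succ.succ)) (fun t => constantCoeff_X _)
    rw [mul_one] at hcorr
    have hL : constantCoeff (C (c 0) + X 1 : MvPowerSeries (Fin 4) k) = c 0 := by
      rw [map_add, constantCoeff_C, constantCoeff_X, add_zero]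
    have hB : constantCoeff (C (c 0) + X 1 + subst ρ v * C (c i'.succ ^ α i') * X 0 ^ (α i' - 1) *
        ∏ t ∈ Finset.univ.erase i', X (Fin.predAbove i'.succ t.succ.succ) ^ α t) = c 0 := by
      rw [map_add, hL, hcorr, add_zero]
    rw [hS, map_mul, map_mul, hL, hB, hρu]
    exact mul_ne_zero hu (mul_ne_zero hc0 hc0)


/-! ## Off the kept-head answer the head drops -/

/-- **A UNIT STRICT TRANSFORM DROPS THE HEAD** (`o ≥ 1`): if the head were kept, the new equation would BE the strict transform
(`Decoration.transform_f_eq_strict_of_o_transform_eq`), of order `o ≥ 1`, not a unit. -/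
theorem head_lt_of_constantCoeff_strict {δ : Decoration k 3} {Φ : Fin 4 → MvPowerSeries (Fin 4) k} {w : Fin 4 → ℕ} {c : Fin 4 → k}
    (hperm : IsBPermissible δ Φ w) (hc : ∀ l, w l = 0 → c l = 0) (hf0 : δ.f ≠ 0) {j : Fin 4} (hcj : c j ≠ 0) (ho : 1 ≤ δ.o)
    (hunit : constantCoeff (δ.strict Φ w c j) ≠ 0) : (δ.transform Φ w c j).head < δ.head := by
  refine lt_of_le_of_ne (Decoration.head_transform_le hperm hc hf0 hcj) fun heq => ?_
  have ho' := Decoration.o_transform_of_head_eq heq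
  have hf' := Decoration.transform_f_eq_strict_of_o_transform_eq hperm hc hf0 hcj ho'
  have h0 : (δ.transform Φ w c j).o = 0 := by
    rw [Decoration.o, hf', ENat.toNat_eq_zero]
    left
    by_contra hne
    exact hunit (order_ne_zero_iff_constCoeff_eq_zero.mp hne)
  omega

end MonomialPair

end TameFourTupleDrop

end Summit.ResolutionOfSingularities.ResolutionOfSingularities.Theorems

end
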